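import Summits.QuantumFields.YangMills.Theorems.BalabanUVNodesN15KingModelGraphPowerCountingRenormLetters
import Summits.QuantumFields.YangMills.Theorems.BalabanUVNodesN15KingModelGraphPowerCountingKingR

/-!
# BalabanUVNodes ∕ N15 — THE KING-MODEL RUNG (PART Λ-a): **«BOUNDED AS BEFORE, WITH THE POSSIBLE ADDITION OF SOME POWER OF ln(L^kε)⁻¹» AS A THEOREM ABOUT GRAPH
# VALUES** — the size half of King 1986 Proposition 3.6's power counting (parts Γ-g∕Γ-h) with the positivity of the partial degrees WEAKENED to non-negativity: a
# zero-degree step along an ordering costs a factor `k + 1` (the number of scales) instead of a geometric constant (part Ε), so graphs with superficially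
# log-divergent subgraphs are bounded by powers of the logarithm, by name at `A = 0`
# (Track A, DAG node N15 = NE2; FAN-OUT v1.1 §N15 s3 «KING-MODEL RUNG … NE2's analogue DECIDED in the model»)

HONEST FRAMING.  Count-neutral (cell `pub-ymgap`, seat `pub-ymgap-dag-n15-e` g28; `--supports stmt-QuantumFields-27366 --as helper` = K3⁸
`SpineGivenEndpointR13SepCoPHV`).  TEMPLATE LITERATURE: C. King, *The U(1) Higgs model. I. The continuum limit*, Commun. Math. Phys. **102** (1986) 649–677
[King1986], §3.4 pp. 663–664 and §3.5 (3.78)–(3.80) p. 666.  Part Γ-g ★★ `sum_le_of_perOrdering` ∕ ★★★ `sum_graphValLS_slices_le_R` and part Γ-h ★★★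
`king_graph_size_uniform_zeroField_R` bound a graph UNIFORMLY in the number of scales when every partial degree along every ordering is POSITIVE; part Ε ★★
`nestedSliceSum_le_degConstLog` bounds the nested slice sums under NON-NEGATIVE partial degrees by `degConstLog` (geometric constant per positive step, `K + 1`
per zero step).  THIS FILE substitutes the latter into the former: the same three theorems with `PosDegrees` weakened to `NonnegDegrees` and `degConst` replaced by
`degConstLog L k` — King's remark for the (3.78) regime, at the level of graph values.  King's U(1)∕`A = 0` MODEL; NOT Bałaban's non-abelian `G(U)` of [B9]; NOT
a node discharge; nothing continuum ∕ ℝ⁴ ∕ OS ∕ mass-gap ∕ Clay.  0 `sorry`; standard axioms.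
THE PRINT.  p. 666 [PDF 18]: *«We get a similar bound for each m_i, i = 2, …, n. Therefore the graph H_ren is bounded as before, with the possible addition of some
power of ln(L^kε)^{−1}.»*; p. 664 [PDF 16]: *«Some of the subgraphs H_i may be divergent.»*
WHAT THIS FILE PROVES (namespace `…N15KingModelRung.Curved`).
* §1 ★ `sum_le_of_perOrdering_log` — part Γ-g's graph-free size core under `NonnegDegrees`: `Σ_j G j ≤ B·Σ_π degConstLog L K (E^π)`.
* §2 ★★ **`sum_graphValLS_slices_le_log_R`** — part Γ-g's generic size half (relabelled certificates) under `NonnegDegrees`.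
* §3 ★★★ **`king_graph_size_log_zeroField_R`** — part Γ-h's size theorem at `A = 0` under NON-NEGATIVE partial degrees along every ordering:
  `|E^{(k)}(H)| ≤ Γ·C₁^m·C₂^n·(Σ_π degConstLog L k (orderList (d+1) (lineExp ∘ κ) π (cert π).F))·Π_{υ≠υ₀} q_υ` — same `(C₁, C₂)` as part Γ-h; each zero-degree
  step contributes at most the number of scales `k + 1 = log_L(η^{−1}) + 1`.
HONEST SCOPE.  (a) SIZE only (UV-finiteness up to logarithms); no two-spacing RATE is claimed for such graphs (they are the ones King renormalises).  (b) The
certificates are user data here; part Λ-b discharges them by Kruskal and by the NON-NEGATIVE subgraph condition, and counts the logarithms for integer exponents.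
(c) `G`∕`∂G` lines; abstract one-vertex factors; King's U(1)∕`A = 0` model; NOT Bałaban's `G(U)`; NE2∕N15 of record untouched; counts unmoved.  Locators:
[King1986] (3.58)–(3.59) p.663, (3.66)–(3.70) p.664, (3.78)–(3.80) p.666.
-/
noncomputable section

namespace Summit.QuantumFields.YangMills.BalabanUVNodes.N15KingModelRung.Curved

open scoped BigOperators
open Finset
open Literature.MathematicalPhysics.QuantumFieldTheory.Balaban1983to89.B5Prop11Plancherel (Tor fine unitVec)
open Literature.MathematicalPhysics.QuantumFieldTheory.King1986.SlicePropagator (SliceKernels TwoSpacing Prop37PrintedAt Prop39PrintedAt)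
open Literature.MathematicalPhysics.QuantumFieldTheory.King1986.ContinuumLimit (eps)
open Summit.QuantumFields.YangMills.BalabanUVNodes.N15KingModelRung (KingVolIndex kingVol kingVol_neZero)
open Summit.QuantumFields.YangMills.BalabanUVNodes.N15KingModelRung.Graph

variable (L : ℕ)

/-! ## §1 The graph-free size core under non-negative partial degrees -/

section CoreLog
variable {m : ℕ}

/-- ★ **THE SIZE CORE WITH LOGARITHMS**: as part Γ-g `sum_le_of_perOrdering`, with the exponent lists only required to have NON-NEGATIVE partial degrees and the
constant `degConstLog L K` (part Ε: `K + 1` per zero step). [cite: King1986, (3.58)–(3.59) p.663, (3.78)–(3.80) p.666] -/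
theorem sum_le_of_perOrdering_log (hL : 2 ≤ L) {K : ℕ} (hK : 1 ≤ K) (G : (Fin m → Fin K) → ℝ) (hG0 : ∀ j, 0 ≤ G j) {B : ℝ} (hB0 : 0 ≤ B)
    (E : Equiv.Perm (Fin m) → Fin m → ℝ) (hper : ∀ (π : Equiv.Perm (Fin m)) (j : Fin m → Fin K), Monotone (j ∘ ⇑π) → G j ≤ B * sliceProd L K (E π) (j ∘ ⇑π))
    (hnn : ∀ π, NonnegDegrees (List.ofFn fun p : Fin m => E π (Fin.rev p))) :
    ∑ j : Fin m → Fin K, G j ≤ B * ∑ π : Equiv.Perm (Fin m), degConstLog L K (List.ofFn fun p : Fin m => E π (Fin.rev p)) := by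
  classical
  refine (sum_le_sum_perm_monotone (β := Fin K) _ hG0).trans ?_
  have hdc : ∀ π : Equiv.Perm (Fin m),
      ∑ j : Fin m → Fin K, (if Monotone (j ∘ ⇑π) then G j else 0) ≤ B * degConstLog L K (List.ofFn fun p : Fin m => E π (Fin.rev p)) := by
    intro π
    calc ∑ j : Fin m → Fin K, (if Monotone (j ∘ ⇑π) then G j else 0)
        ≤ ∑ j : Fin m → Fin K, (if Monotone (j ∘ ⇑π) then B * sliceProd L K (E π) (j ∘ ⇑π) else 0) := by
          refine sum_le_sum fun j _ => ?_
          split_ifs with h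
          · exact hper π j h
          · exact le_rfl
      _ = B * ∑ j : Fin m → Fin K, (if Monotone j then sliceProd L K (E π) j else 0) := by
          rw [mul_sum, ← sum_comp_perm_eq π (fun j : Fin m → Fin K => B * (if Monotone j then sliceProd L K (E π) j else 0))]
          refine sum_congr rfl fun j _ => ?_
          split_ifs <;> simp
      _ = B * nestedSliceSum L K (List.ofFn fun p : Fin m => E π (Fin.rev p)) (K - 1) := by rw [sum_monotone_sliceProd_eq_top L hK]
      _ ≤ B * degConstLog L K (List.ofFn fun p : Fin m => E π (Fin.rev p)) :=
          mul_le_mul_of_nonneg_left (nestedSliceSum_le_degConstLog L hL K (hnn π) (by omega)) hB0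
  refine (sum_le_sum fun π _ => hdc π).trans (le_of_eq ?_)
  rw [← mul_sum]

end CoreLog

/-! ## §2 The generic size half with relabelled certificates, log edition -/

section AssemblyLog
variable {S : Type*} [Fintype S] [Nonempty S] {Υ : Type*} [Fintype Υ] [DecidableEq Υ]
variable {n m : ℕ} {src tgt : Fin m → Fin (n + 1)}

/-- ★★ **THE GENERIC SIZE HALF WITH LOGARITHMS** — part Γ-g `sum_graphValLS_slices_le_R` with the partial degrees of the order lists only NON-NEGATIVE:
`Σ_j 𝔼(H(j)) ≤ Γ·Cst^m·cV^n·(Σ_π degConstLog L K (orderList … π (cert π).F))·Π_{υ≠υ₀} q_υ`. [cite: King1986, (3.58)–(3.59) p.663, (3.66)–(3.70) p.664, (3.78)–(3.80) p.666] -/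
theorem sum_graphValLS_slices_le_log_R (hL : 2 ≤ L) {K : ℕ} (hK : 1 ≤ K) (vtx : Υ → Fin (n + 1)) {ω : ℝ} (hω : 0 ≤ ω)
    (P : Fin m → Fin K → S → S → ℝ) (hP0 : ∀ ℓ c x y, 0 ≤ P ℓ c x y) {Cst cV : ℝ} (hCst : 0 ≤ Cst) (hcV : 0 ≤ cV) (dV : ℝ) (e : Fin m → ℝ)
    (hsup : ∀ ℓ c x y, P ℓ c x y ≤ Cst * ((L : ℝ) ^ ((c : ℕ)) * eps L K) ^ e ℓ)
    (hrow : ∀ ℓ c y, ∑ a, ω * P ℓ c y a ≤ Cst * cV * ((L : ℝ) ^ ((c : ℕ)) * eps L K) ^ (e ℓ + dV))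
    (hcol : ∀ ℓ c y, ∑ a, ω * P ℓ c a y ≤ Cst * cV * ((L : ℝ) ^ ((c : ℕ)) * eps L K) ^ (e ℓ + dV))
    (p : Υ → S → ℝ) (hp0 : ∀ υ x, 0 ≤ p υ x) (υ₀ : Υ) (hυ₀ : vtx υ₀ = 0) {Γ : ℝ} (hΓ : ∑ x, ω * p υ₀ x ≤ Γ)
    (q : Υ → ℝ) (hq : ∀ υ, υ ≠ υ₀ → ∀ x, p υ x ≤ q υ)
    (cert : Equiv.Perm (Fin m) → ForestCertR n src tgt) (hnn : ∀ π, NonnegDegrees (orderList dV e π (cert π).F)) :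
    ∑ j : Fin m → Fin K, graphValLS ω src tgt (fun ℓ => P ℓ (j ℓ)) vtx p
      ≤ Γ * (Cst ^ m * cV ^ n * (∑ π : Equiv.Perm (Fin m), degConstLog L K (orderList dV e π (cert π).F)) * ∏ υ ∈ univ.erase υ₀, q υ) := by
  classical
  obtain ⟨x₀⟩ := ‹Nonempty S›
  have hΓ0 : 0 ≤ Γ := (sum_nonneg fun x _ => mul_nonneg hω (hp0 _ _)).trans hΓ
  have hq0 : 0 ≤ ∏ υ ∈ univ.erase υ₀, q υ := prod_nonneg fun υ hυ => (hp0 υ x₀).trans (hq υ (ne_of_mem_erase hυ) x₀)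
  have hB0 : 0 ≤ Γ * (Cst ^ m * cV ^ n * ∏ υ ∈ univ.erase υ₀, q υ) :=
    mul_nonneg hΓ0 (mul_nonneg (mul_nonneg (pow_nonneg hCst _) (pow_nonneg hcV _)) hq0)
  have h := sum_le_of_perOrdering_log L hL hK (fun j => graphValLS ω src tgt (fun ℓ => P ℓ (j ℓ)) vtx p)
    (fun j => graphValLS_nonneg' src tgt vtx hω _ (fun ℓ => hP0 ℓ _) p hp0) hB0 (fun π => orderExps dV e π (cert π).F)
    (fun π j _ => by
      have h := graphValLS_le_of_forestCertR (cert π) vtx hω (fun ℓ => P ℓ (j ℓ)) (fun ℓ => hP0 ℓ _) p hp0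
        (fun ℓ => Cst * ((L : ℝ) ^ ((j ℓ : ℕ)) * eps L K) ^ e ℓ) (fun ℓ _ x y => hsup ℓ _ x y)
        (fun i => Cst * cV * ((L : ℝ) ^ ((j ((cert π).F.tl i) : ℕ)) * eps L K) ^ (e ((cert π).F.tl i) + dV))
        (fun i y => hrow _ _ y) (fun i y => hcol _ _ y) υ₀ hυ₀ hΓ q hq
      rw [lineConstants_eq L K (cert π).F π Cst cV dV e j] at h
      refine h.trans (le_of_eq ?_)
      ring)
    hnn
  refine h.trans (le_of_eq ?_)
  unfold orderList
  ring

end AssemblyLog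

/-! ## §3 King's graphs at `A = 0`: UV-finiteness up to logarithms under non-negative partial degrees -/

section SizeLog
variable {d : ℕ} [NeZero L]

/-- ★★★ **THE SIZE OF A GENERAL GRAPH WITH KING's FULL `A = 0` PROPAGATORS, UP TO LOGARITHMS, UNDER NON-NEGATIVE PARTIAL DEGREES ALONG EVERY ORDERING** — part
Γ-h `king_graph_size_uniform_zeroField_R` with `PosDegrees` weakened to `NonnegDegrees` and the constant `degConst` replaced by `degConstLog L k` (each zero-degree
step along an ordering contributes at most the number of scales `k + 1 = log_L(η^{−1}) + 1`, part Ε): for odd `L ≥ 3`, `a > 0`, `m₀² ≥ 0` there are `C₁, C₂ > 0` such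
that for every `k ≥ 1`, cube `M = 2L^{e_M}`, mass `0 < m² ≤ m₀²`, every numbered graph (lines `G^η_k`∕`∂^η_μG^η_k`), one-vertex factors with sizes `q_υ` and a
root-placed factor with `Σ_x η^{d+1}|u_{υ₀}(x)| ≤ Γ`, and every family of relabelled certificates `cert π` whose order lists have NON-NEGATIVE partial degrees:
`|E^{(k)}(H)| ≤ Γ·C₁^m·C₂^n·(Σ_π degConstLog L k (orderList (d+1) (lineExp ∘ κ) π (cert π).F))·Π_{υ≠υ₀} q_υ` — King's «bounded as before, with the possible
addition of some power of ln(L^kε)^{−1}». [cite: King1986, (2.17) p.653, (3.58)–(3.59) p.663, Prop. 3.7 (3.63) p.663, (3.66)–(3.70) p.664, (3.78)–(3.80) p.666] -/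
theorem king_graph_size_log_zeroField_R (hLodd : Odd L) (hL : 2 ≤ L) {a : ℝ} (ha : 0 < a) {m0sq : ℝ} (hm0 : 0 ≤ m0sq) :
    ∃ C₁ C₂ : ℝ, 0 < C₁ ∧ 0 < C₂ ∧ ∀ (k eM : ℕ) (hk : 1 ≤ k) (M : Fin (d + 1) → ℕ) [∀ μ, NeZero (M μ)] (hM : ∀ μ, M μ = 2 * L ^ eM)
      (msq : ℝ), 0 < msq → msq ≤ m0sq →
      ∀ (n m : ℕ) (src tgt : Fin m → Fin (n + 1)) (κ : Fin m → Option (Fin (d + 1)))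
        (Υ : Type) [Fintype Υ] [DecidableEq Υ] (vtx : Υ → Fin (n + 1)) (u : Υ → Tor (fine (L ^ k) M) → ℝ) (q : Υ → ℝ) (υ₀ : Υ) (Γ : ℝ),
        vtx υ₀ = 0 → (∀ υ, υ ≠ υ₀ → ∀ x, |u υ x| ≤ q υ) → (∑ x, (((L : ℝ) ^ k)⁻¹) ^ (d + 1) * |u υ₀ x| ≤ Γ) →
        ∀ cert : Equiv.Perm (Fin m) → ForestCertR n src tgt,
          (∀ π, NonnegDegrees (orderList ((d + 1 : ℕ) : ℝ) (fun ℓ => lineExp (d + 1) (κ ℓ)) π (cert π).F)) →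
          |graphValLS ((((L : ℝ) ^ k)⁻¹) ^ (d + 1)) src tgt (fun ℓ => kingGLine L M a msq k (κ ℓ)) vtx u|
            ≤ Γ * (C₁ ^ m * C₂ ^ n
                * (∑ π : Equiv.Perm (Fin m), degConstLog L k (orderList ((d + 1 : ℕ) : ℝ) (fun ℓ => lineExp (d + 1) (κ ℓ)) π (cert π).F))
                * ∏ υ ∈ univ.erase υ₀, q υ) := by
  obtain ⟨C, δ₀, hC, hδ₀, H⟩ := prop37PrintedAt_king_zeroField (d := d) L hLodd hL ha hm0 (α := 1 / 2) (by norm_num) (by norm_num)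
  refine ⟨C, c368 d δ₀, hC, c368_pos d hδ₀,
    fun k eM hk M _ hM msq hm hcap n m src tgt κ Υ _ _ vtx u q υ₀ Γ hυ₀ hq hΓ cert hnn => ?_⟩
  have h37 := H k eM hk M hM msq hm hcap
  have hL1 : 1 ≤ L := by omega
  have hw0 : (0 : ℝ) ≤ (((L : ℝ) ^ k)⁻¹) ^ (d + 1) := by positivity
  haveI : Nonempty (Tor (fine (L ^ k) M)) := ⟨fun _ => 0⟩
  -- (2.17) multiplied out, the majorant graph of each `H(j)`
  rw [graphValLS_kingGLine_eq_sum L hL ha hk M hM hm _ src tgt κ vtx u]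
  refine (Finset.abs_sum_le_sum_abs _ _).trans ?_
  refine (sum_le_sum fun j _ => abs_graphValLS_le _ src tgt _ vtx u).trans ?_
  rw [abs_of_nonneg hw0]
  -- §2 with Prop. 3.7 by name
  exact sum_graphValLS_slices_le_log_R L hL hk vtx hw0
    (fun ℓ (c : Fin k) (x y : Tor (fine (L ^ k) M)) => |sliceLine (kingSliceKernels L k eM M hM hk a msq) (c : ℕ) (κ ℓ) x y|)
    (fun ℓ c x y => abs_nonneg _) hC.le (c368_pos d hδ₀).le (((d + 1 : ℕ) : ℝ)) (fun ℓ => lineExp (d + 1) (κ ℓ))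
    (fun ℓ c x y => abs_sliceLine_le_sup L hk M hM hC.le hδ₀.le h37 (by have := c.isLt; omega) (κ ℓ) x y)
    (fun ℓ c y => lineSum_sliceLine_le_row L hL1 hk M hM hC.le hδ₀ h37 (by have := c.isLt; omega) (κ ℓ) y)
    (fun ℓ c y => lineSum_sliceLine_le_col L hL1 hk M hM hC.le hδ₀ h37 (by have := c.isLt; omega) (κ ℓ) y)
    (fun υ x => |u υ x|) (fun υ x => abs_nonneg _) υ₀ hυ₀ hΓ q hq cert hnn

end SizeLog

end Summit.QuantumFields.YangMills.BalabanUVNodes.N15KingModelRung.Curved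

end
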